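import Summits.Ventures.LatticeQCDFlow.Exactness.IMHModeHolding
import HarnessLib

/-!
# The acceptance mass of flow-MCMC is antitone in the weight: the mode is the stickiest state

HONEST FRAMING: exact (Metropolis-corrected) sampling algorithms for lattice gauge theory;
figures of merit are autocorrelation/cost numbers at stated couplings and volumes; no
continuum-physics claim.

Venture `LatticeQCDFlow` (cell pub-lqcd), topic `Exactness`; FANOUT row 30 (lean-1, GEN-28).  NEW WORK of the
cell, general state space.  For the independence Metropolis–Hastings kernel `indepMH q w` of
`Exactness/IMHKernel.lean` (acceptance `min{1, w(y)/w(x)}`, acceptance mass `A(x)`):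

* **`imhAccept_anti`**, **`imhAcceptMass_anti`** — `w(x) ≤ w(x')` implies `a(x', y) ≤ a(x, y)` for every `y` and
  `A(x') ≤ A(x)`: the larger the importance weight of the current state, the smaller its acceptance mass;
* **`imhAcceptMass_mode_le`** — a mode `x₀` of the weight is the STICKIEST state: `A(x₀) ≤ A(x)` for every `x`;
  with `Exactness/IMHModeHolding` (`A(x₀) = Z/w(x₀)` exactly): **`imhAcceptMass_toReal_ge_of_mode`**
  `Z/w(x₀) ≤ A(x)` for every `x` — every state is left at least as fast as the mode, and
  (**`indepMH_apply_singleton_le_of_mode`**) at an atom-free state `x` the holding probability is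
  `K(x, {x}) = 1 − A(x) ≤ 1 − Z/w(x₀)`.

Reading for the gauge samplers (`Scaling/AutoregressiveGaugeHeatBathColdExact` ∕ `…AllClosingColdExact`): the
cold configuration is the stickiest configuration of both exact samplers; every other configuration is left
with probability at least the exact cold escape rate (`Scaling/AutoregressiveGaugeColdStickiest`).

No `sorry`, nothing cited as a fact; general measurable space.
-/

noncomputable section

namespace Summit.Ventures.LatticeQCDFlow.Exactness

open MeasureTheory ProbabilityTheory Function
open scoped ENNReal

variable {Ω : Type*} [MeasurableSpace Ω]
variable {q : Measure Ω} {w : Ω → ℝ}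

omit [MeasurableSpace Ω] in
/-- **The acceptance probability is antitone in the weight of the current state.** [ours] -/
theorem imhAccept_anti (hw0 : ∀ y, 0 < w y) {x x' : Ω} (hle : w x ≤ w x') (y : Ω) :
    imhAccept w x' y ≤ imhAccept w x y := by
  unfold imhAccept
  exact min_le_min le_rfl (div_le_div_of_nonneg_left (hw0 y).le (hw0 x) hle)

/-- **The acceptance mass is antitone in the weight of the current state.** [ours] -/
theorem imhAcceptMass_anti (hw0 : ∀ y, 0 < w y) {x x' : Ω} (hle : w x ≤ w x') :
    imhAcceptMass q w x' ≤ imhAcceptMass q w x := by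
  unfold imhAcceptMass imhAcceptE
  exact lintegral_mono fun y => ENNReal.ofReal_le_ofReal (imhAccept_anti hw0 hle y)

/-- **A mode of the weight is the stickiest state**: `A(x₀) ≤ A(x)` for every `x`. [ours] -/
theorem imhAcceptMass_mode_le (hw0 : ∀ y, 0 < w y) {x₀ : Ω} (hmax : ∀ y, w y ≤ w x₀) (x : Ω) :
    imhAcceptMass q w x₀ ≤ imhAcceptMass q w x :=
  imhAcceptMass_anti hw0 (hmax x)

/-- **Every state is left at least as fast as the mode**: `Z/w(x₀) ≤ A(x)` (`Z = ∫ w dq`). [ours] -/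
theorem imhAcceptMass_toReal_ge_of_mode [IsProbabilityMeasure q] (hw0 : ∀ y, 0 < w y) {x₀ : Ω}
    (hmax : ∀ y, w y ≤ w x₀) {Z : ℝ} (hZ0 : 0 ≤ Z) (hZ : ∫⁻ y, ENNReal.ofReal (w y) ∂q = ENNReal.ofReal Z)
    (x : Ω) : Z / w x₀ ≤ (imhAcceptMass q w x).toReal := by
  rw [← imhAcceptMass_toReal_eq_of_forall_le hw0 x₀ hmax hZ0 hZ]
  exact ENNReal.toReal_mono (ne_top_of_le_ne_top ENNReal.one_ne_top (imhAcceptMass_le_one q w x))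
    (imhAcceptMass_mode_le hw0 hmax x)

/-- **At an atom-free state the holding probability is at most the mode's**:
`K(x, {x}) = 1 − A(x) ≤ 1 − A(x₀)`. [ours] -/
theorem indepMH_apply_singleton_le_of_mode [MeasurableSingletonClass Ω] [IsProbabilityMeasure q]
    (hw : Measurable w) (hw0 : ∀ y, 0 < w y) {x₀ : Ω} (hmax : ∀ y, w y ≤ w x₀) {x : Ω} (hqx : q {x} = 0) :
    indepMH q w x {x} ≤ 1 - imhAcceptMass q w x₀ := by
  rw [indepMH_apply_singleton_eq hw hqx]
  exact tsub_le_tsub_left (imhAcceptMass_mode_le hw0 hmax x) 1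

end Summit.Ventures.LatticeQCDFlow.Exactness
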